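import Literature.AnabelianGeometry.EtaleTheta.ThetaCoversAxOfSetting
import HarnessLib

/-!
# [EtTh] §2: `Δ̄_Θ` IS the image of the commutator subgroup — the binder `hΘ` (GAP G-L2d3-1) PROVED at every
# theta setting of [EtTh] origin (p. 261–262 / PDF pp. 35–36)

Mochizuki, *The étale theta function …*, Publ. RIMS **45** (2009), §1 p.238 (PDF p.12) "`Δ_Θ := Im(∧² Δ^ab_X)`" and
§2 pp.261–262 (PDF pp.35–36) "`1 → Δ̄_Θ → Δ̄_X → Δ̄^ell_X → 1`, `Δ̄_Θ ≅ (ℤ/lℤ)(1)`" [cite: MochizukiEtTh2009, Def 2.1 p.35].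
Layer L2 of the abc-iut cell, seat abc-iut-L2-t11 (gen 3); L2-lead ROW #13-addendum R158 = GAP-LEDGER row **G-L2d3-1**:
the residual hypothesis `hΘ : ⁅X.DeltaX, X.DeltaX⁆ ⊔ X.barKer = X.barTheta` of abc-iut-L2-d3's `TemperedCoverData.rmk261_of`
(Rmk. 2.6.1) and of the `X̲̲`-member of Cor. 2.9 — NOT a field of abc-iut-L2-t2's interface `ThetaCovers.CoverData`, which only
records `Δ̄_Θ` through `relIndex_barKer = l`, centrality and `ell_rank_two`.  PROOF-ONLY (no definition, no named fact,
nothing of another seat edited).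

WHAT.  At abc-iut-L2-t10's phase-1a/2a constructions (`ThetaCoversModelDefs`, `ThetaCoversModelPiC`,
`ThetaCoversAxOfSetting`, consumed BY NAME) the two subgroups are, by DEFINITION, `barKerHat l = closure(⁅⁅Δ,Δ⁆,Δ⁆ · Δ^l)` and
`barThetaHat l = closure(⁅Δ,Δ⁆ · Δ^l)` (`Δ = Δ_X = D.DeltaHat ⊆ Π_X = D.PiHat`).  Hence `hΘ` — `⁅Δ,Δ⁆ ⊔ barKer = barTheta` — is
the statement that `⁅Δ,Δ⁆ · barKerHat` is already CLOSED.  It is, for every theta setting of [EtTh] origin and every odd `l`, by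
pure topological group theory: `barKerHat` is closed (`isClosed_barKerHat`) of finite index `l · l²` in `Δ` (abc-iut-L2-t10's
`IsEtThOrigin.relIndex_barKerHat` and `IsEtThOrigin.nonempty_quotient_barThetaHat_mulEquiv`, `Δ/barThetaHat ≅ (ℤ/l)²`), hence
OPEN in the subgroup `Δ` (`Subgroup.isOpen_of_isClosed_of_finiteIndex`), so every intermediate subgroup `barKerHat ≤ M ≤ Δ` is
open-hence-closed in `Δ`, hence closed in `Π_X` (`Δ` is closed) — no Nikolov–Segal-type input.  THEOREMS:
* `ThetaSetting.IsEtThOrigin.commutator_sup_barKerHat` — `⁅Δ_X, Δ_X⁆ ⊔ barKerHat l = barThetaHat l` in `Π_X`;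
* `ThetaSetting.PiCData.commutator_sup_barKer` — the same inside `Π_C` for abc-iut-L2-t10's input bundle `I : D.PiCData PiC`
  (transport along `Π_X ↪ Π_C`: `barKer_eq_map`, `barTheta_eq_map`, `deltaX_eq`);
* `ThetaSetting.PiCData.coverDataAx_hTheta` — **`hΘ` VERBATIM** (`⁅X.DeltaX, X.DeltaX⁆ ⊔ X.barKer = X.barTheta`) for the
  `CoverData` underlying abc-iut-L2-t10's `PiCData.coverDataAx` (the `CoverDataAx` of a theta setting, merge row W3-L2-02 /
  P2-a): at setting-born cover data G-L2d3-1 is a THEOREM, so abc-iut-L2-t2's interface needs no extra field there.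
HONEST FRAMING: kernel-checked consequences of abc-iut-L2-t10's constructions under the guard `IsEtThOrigin` (via
`OncePuncturedData.origin`); nothing of [EtTh] is asserted unconditionally; typed ≠ proved; no side is taken on anything downstream
([IUTchIII] Cor. 3.12).
-/

noncomputable section

namespace Literature.AnabelianGeometry.EtaleTheta

namespace ThetaSetting

open Literature.AnabelianGeometry.SemiGraphs

variable {p : ℕ} [Fact p.Prime] {D : ThetaSetting p} (l : ℕ)

/-- In a topological group: a subgroup `M` squeezed between a CLOSED subgroup `K` of FINITE index in a CLOSED subgroup `A`
(`K ≤ M ≤ A`, `[A : K] ≠ 0`) is closed — `K` is open in `A`, so `M` is open-hence-closed in `A`. [folklore] -/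
private theorem isClosed_of_le_of_relIndex_ne_zero {G : Type*} [Group G] [TopologicalSpace G]
    [IsTopologicalGroup G] {K M A : Subgroup G} (hKM : K ≤ M) (hMA : M ≤ A) (hK : IsClosed (K : Set G))
    (hA : IsClosed (A : Set G)) (hidx : K.relIndex A ≠ 0) : IsClosed (M : Set G) := by
  haveI : (K.subgroupOf A).FiniteIndex := ⟨hidx⟩
  have hKo : IsOpen ((K.subgroupOf A : Subgroup A) : Set A) :=
    Subgroup.isOpen_of_isClosed_of_finiteIndex _ (hK.preimage continuous_subtype_val)
  have hMo : IsOpen ((M.subgroupOf A : Subgroup A) : Set A) :=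
    Subgroup.isOpen_mono (fun x hx => hKM hx) hKo
  have hMc : IsClosed ((M.subgroupOf A : Subgroup A) : Set A) := Subgroup.isClosed_of_isOpen _ hMo
  have himg : (M : Set G) = ((↑) : A → G) '' ((M.subgroupOf A : Subgroup A) : Set A) := by
    ext x
    constructor
    · intro hx
      exact ⟨⟨x, hMA hx⟩, hx, rfl⟩
    · rintro ⟨y, hy, rfl⟩
      exact hy
  rw [himg]
  exact hA.isClosedEmbedding_subtypeVal.isClosedMap _ hMc

/-- **`Δ̄_Θ` is the image of `⁅Δ_X, Δ_X⁆`** at a theta setting of [EtTh] origin (`l` odd): in `Π_X`,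
`⁅Δ_X, Δ_X⁆ ⊔ Ker(Δ_X ↠ Δ̄_X) = ` the `Δ̄_Θ`-preimage, i.e. `⁅Δ,Δ⁆ · closure(⁅⁅Δ,Δ⁆,Δ⁆·Δ^l) = closure(⁅Δ,Δ⁆·Δ^l)` ("`Δ_Θ :=
Im(∧² Δ^ab_X)`", p.238; "`1 → Δ̄_Θ → Δ̄_X → Δ̄^ell_X → 1`", p.261) — because `Ker(Δ_X ↠ Δ̄_X)` is closed of finite index
`l³` in `Δ_X`, so `⁅Δ,Δ⁆ · Ker` is closed. [cite: MochizukiEtTh2009, Def 2.1 p.35] -/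
theorem IsEtThOrigin.commutator_sup_barKerHat (hO : D.IsEtThOrigin) (hodd : Odd l) :
    ⁅D.DeltaHat, D.DeltaHat⁆ ⊔ D.barKerHat l = D.barThetaHat l := by
  haveI : NeZero l := ⟨by obtain ⟨k, hk⟩ := hodd; omega⟩
  haveI : (D.barThetaHat l).Normal := D.barThetaHat_normal l
  haveI : D.DeltaHat.Normal := D.deltaHat_normal'
  refine le_antisymm (sup_le (D.commutator_le_barThetaHat l) (D.barKerHat_le_barThetaHat l)) ?_
  -- finite index of `barKerHat` in `Δ_X`: `l · l²`
  obtain ⟨ε⟩ := hO.nonempty_quotient_barThetaHat_mulEquiv l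
  haveI : Finite (↥D.DeltaHat ⧸ (D.barThetaHat l).subgroupOf D.DeltaHat) := Finite.of_equiv _ ε.toEquiv.symm
  haveI hfi : ((D.barThetaHat l).subgroupOf D.DeltaHat).FiniteIndex := Subgroup.finiteIndex_of_finite_quotient
  have h2 : (D.barThetaHat l).relIndex D.DeltaHat ≠ 0 := hfi.index_ne_zero
  have h3 : (D.barKerHat l).relIndex D.DeltaHat ≠ 0 := by
    rw [← Subgroup.relIndex_mul_relIndex (D.barKerHat l) (D.barThetaHat l) D.DeltaHat
      (D.barKerHat_le_barThetaHat l) (D.barThetaHat_le_deltaHat l), hO.relIndex_barKerHat l hodd]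
    exact mul_ne_zero (NeZero.ne l) h2
  -- hence `⁅Δ,Δ⁆ ⊔ barKerHat` is closed, and contains `⁅Δ,Δ⁆ ⊔ Δ^l`
  have hclosed : IsClosed ((⁅D.DeltaHat, D.DeltaHat⁆ ⊔ D.barKerHat l : Subgroup D.PiHat) : Set D.PiHat) :=
    isClosed_of_le_of_relIndex_ne_zero le_sup_right
      (sup_le (Subgroup.commutator_le_left _ _)
        ((D.barKerHat_le_barThetaHat l).trans (D.barThetaHat_le_deltaHat l)))
      (D.isClosed_barKerHat l) (Subgroup.isClosed_topologicalClosure _) h3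
  exact Subgroup.topologicalClosure_minimal _ (sup_le_sup_left (D.deltaHatPow_le_barKerHat l) _) hclosed

namespace PiCData

variable {PiC : Type} [Group PiC] [TopologicalSpace PiC] [IsTopologicalGroup PiC] [T2Space PiC]
  (I : D.PiCData PiC)

/-- **`hΘ` inside `Π_C`**: for abc-iut-L2-t10's input bundle `I` (`Π_X ↪ Π_C`) and a once-punctured datum `e` (which carries
the [EtTh]-origin guard and `Ker(Π_X → G_K) = Δ_X`), `⁅Δ_X, Δ_X⁆ ⊔ barKer = barTheta` with `Δ_X = Π_X ∩ Δ_C` — transported from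
`commutator_sup_barKerHat` along the embedding (`barKer_eq_map`, `barTheta_eq_map`, `deltaX_eq`).
[cite: MochizukiEtTh2009, Def 2.1 p.35] -/
theorem commutator_sup_barKer (e : D.OncePuncturedData) (hodd : Odd l) :
    ⁅I.PiX ⊓ I.augGK.ker, I.PiX ⊓ I.augGK.ker⁆ ⊔ I.barKer l = I.barTheta l := by
  rw [← I.deltaX_eq e, I.barKer_eq_map l e, I.barTheta_eq_map l e, PiCData.DeltaX, ← Subgroup.map_commutator,
    ← Subgroup.map_sup, e.origin.commutator_sup_barKerHat l hodd]

/-- **GAP G-L2d3-1 (`hΘ`) at setting-born cover data, VERBATIM**: for the `CoverData` underlying abc-iut-L2-t10's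
`PiCData.coverDataAx` (the `CoverDataAx` of a theta setting of [EtTh] origin; W3-L2-02 / P2-a),
`⁅X.DeltaX, X.DeltaX⁆ ⊔ X.barKer = X.barTheta` — the binder of abc-iut-L2-d3's `TemperedCoverData.rmk261_of` and of the
`X̲̲`-member of Cor. 2.9.  [cite: MochizukiEtTh2009, Def 2.1 p.35] -/
theorem coverDataAx_hTheta (e : D.OncePuncturedData) {x : D.Pt} (hx : D.IsCusp x) (hodd : Odd l)
    (hIx : (I.Dx x ⊓ I.augGK.ker) ⊔ I.barKer l = I.barTheta l)
    (hιell : ∀ c ∈ I.augGK.ker, c ∉ I.PiX → ∀ d ∈ I.PiX ⊓ I.augGK.ker, c * d * c⁻¹ * d ∈ I.barTheta l)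
    (hιtheta : ∀ c ∈ I.augGK.ker, c ∉ I.PiX → ∀ t ∈ I.barTheta l, c * t * c⁻¹ * t⁻¹ ∈ I.barKer l) :
    ⁅(I.coverDataAx l e hx hodd hIx hιell hιtheta).toCoverData.DeltaX,
        (I.coverDataAx l e hx hodd hIx hιell hιtheta).toCoverData.DeltaX⁆ ⊔
        (I.coverDataAx l e hx hodd hIx hιell hιtheta).barKer =
      (I.coverDataAx l e hx hodd hIx hιell hιtheta).barTheta :=
  I.commutator_sup_barKer l e hodd

end PiCData

end ThetaSetting

end Literature.AnabelianGeometry.EtaleTheta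

end
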